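import Literature.NumberTheory.EllipticCurves.TianYuanZhang2017.GenusPointDescentDisplays
import Literature.NumberTheory.EllipticCurves.TianYuanZhang2017.GenusDescentEnSide
import HarnessLib

/-!
# Tian–Yuan–Zhang, W2 kernel: the DEFINITIONS (defs-first cut, p2-lead ML-60 (c))

W2 (p2-lead ML-56/ML-60; p2-monsky-lit GEN 8).  Every new `def`/`abbrev`/`instance` of the W2 deduction files
`GenusDescentBrackets`, `GenusDescentTwist`, `UPlusOfGenusPointData` is collected HERE (so that those three files are
proof-only), together with the four lemmas the definitions need for well-definedness (`θn_sq`, `θn_ne_zero`,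
`Atwo_eq_twist`, `CE_smul`).  Objects: the brackets of the proof of Thm. 3.5 (2) as (decomposition, main-block)
double sums over p2-lit-1's displayed `MainBlock`/`gK` (`coef`, `bFivePlain`, `bFiveI`, `bSix`, `bSeven`); the
`(5,3,2)` coefficient `cI` and the `τ`-type `tauType` of a main block; `A₂(H)`-points (`A2Point`), `N_A, N_E = β′ + 1`
(`normA`, `normE`), `φ_H` (`φH`); the twist transfer `Θ_A : A_n′(ℚ) →+ A(K_n)`, `Θ_E : E_n(ℚ) →+ A₂(K_n)`
(`(X, Y) ↦ (X/θ², Y/θ³)`, `θ = √−n`, via the tree's `untwistEquivAt` after the EQUATION identities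
`A_n′ = A^{(−n)}`, `(1/2;0,0,0)•E_n = A₂^{(−n)}`), the base change of `ℚ`-points `ιK`, the scaling `CE`.
No `def … : Prop` (no named fact), no sorry; nothing about BSD is asserted.  HONEST FRAMING: consumed by the
proof-only W2 files `GenusDescentBrackets`, `GenusDescentTwist`, `UPlusOfGenusPointData`; U⁺ becomes a theorem
MODULO `tyz_genusPointData` + GZK only when `UPlusOfGenusPointData` lands.

## References
* Y. Tian, X. Yuan, S.-W. Zhang, Asian J. Math. 21 (2017), arXiv:1411.4728, §1 (p0002 L101–L110), §3.1 (p0011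
  L27–L36), Thm. 1.2 (p0002 L115–L127), proof of Thm. 3.5 (2) (p0020 L107–L165). [TianYuanZhang2017]
* J. H. Silverman, *The Arithmetic of Elliptic Curves*, 2nd ed., X.5 Cor. 5.4. [SilvermanAEC2009]
-/

noncomputable section

open scoped Classical
open Finset

namespace Literature.NumberTheory.EllipticCurves.TianYuanZhang2017.W2

open _root_.WeierstrassCurve _root_.WeierstrassCurve.Affine
open Literature.NumberTheory.EllipticCurves
open Literature.NumberTheory.EllipticCurves.TianYuanZhang2017

variable {n : ℕ}

/-! ### Brackets as double sums over (decomposition, main block) -/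

/-- The bracket with main block of TYPE `Q`: `Σ_{S} Σ_{d₀ ∈ S main, Q S d₀} ∏_{d ∈ S} g(d)`. [cite: TianYuanZhang2017, Thm. 1.2 (chunk p0002 L115–L127) and proof of Thm. 3.5 (2) (p0020 L123–L165)] -/
def coef (n : ℕ) (Q : Finset ℕ → ℕ → Prop) : ℕ :=
  ∑ S ∈ decompositions n, ∑ d₀ ∈ S.filter (fun d₀ => MainBlock S d₀),
    if Q S d₀ then ∏ d ∈ S, gK d else 0

/-- Main block `≡ 5 (mod 8)` WITHOUT a block `≡ 3` (the `ε = ±1` type). [cite: TianYuanZhang2017, Thm. 1.2 (chunk p0002 L115–L127) and proof of Thm. 3.5 (2) (p0020 L123–L165)] -/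
def QFivePlain (S : Finset ℕ) (d₀ : ℕ) : Prop := d₀ % 8 = 5 ∧ ¬ ∃ d ∈ S, d % 8 = 3

/-- Main block `≡ 5 (mod 8)` WITH a block `≡ 3` (the `ε = ±i` type). [cite: TianYuanZhang2017, Thm. 1.2 (chunk p0002 L115–L127) and proof of Thm. 3.5 (2) (p0020 L123–L165)] -/
def QFiveI (S : Finset ℕ) (d₀ : ℕ) : Prop := d₀ % 8 = 5 ∧ ∃ d ∈ S, d % 8 = 3

/-- Main block `≡ 6 (mod 8)`. [cite: TianYuanZhang2017, Thm. 1.2 (chunk p0002 L115–L127) and proof of Thm. 3.5 (2) (p0020 L123–L165)] -/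
def QSix (_S : Finset ℕ) (d₀ : ℕ) : Prop := d₀ % 8 = 6

/-- Main block `≡ 7 (mod 8)`. [cite: TianYuanZhang2017, Thm. 1.2 (chunk p0002 L115–L127) and proof of Thm. 3.5 (2) (p0020 L123–L165)] -/
def QSeven (_S : Finset ℕ) (d₀ : ℕ) : Prop := d₀ % 8 = 7

/-- `B₅` (plain type), `B₅` (`i` type), `B₆`, `B₇`. [cite: TianYuanZhang2017, Thm. 1.2 (chunk p0002 L115–L127) and proof of Thm. 3.5 (2) (p0020 L123–L165)] -/
def bFivePlain (n : ℕ) : ℕ := coef n QFivePlain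

/-- The bracket `B₅ᵢ`: main block `≡ 5 (mod 8)` together with a block `≡ 3` (the `ε = ±i` type of Prop. 3.4). [cite: TianYuanZhang2017, Thm. 1.2 (chunk p0002 L115–L127) and proof of Thm. 3.5 (2) (p0020 L123–L165)] -/
def bFiveI (n : ℕ) : ℕ := coef n QFiveI

/-- The bracket `B₆`: main block `≡ 6 (mod 8)` (p0020 L153–L155). [cite: TianYuanZhang2017, Thm. 1.2 (chunk p0002 L115–L127) and proof of Thm. 3.5 (2) (p0020 L123–L165)] -/
def bSix (n : ℕ) : ℕ := coef n QSix

/-- The bracket `B₇`: main block `≡ 7 (mod 8)` (p0020 L130–L133 / L155–L158). [cite: TianYuanZhang2017, Thm. 1.2 (chunk p0002 L115–L127) and proof of Thm. 3.5 (2) (p0020 L123–L165)] -/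
def bSeven (n : ℕ) : ℕ := coef n QSeven

/-! ### `A₂`, `β′ + 1`, `φ_H`; the `(5,3,2)` coefficient and the `τ`-type of a main block -/

/-- `A₂(H)`: the `H`-points of `A₂ = curveA.twoIsogenyCodomain = (Y² = X³ − 16X)`. [cite: TianYuanZhang2017, §3.1 (chunk p0011 L27–L36, A(K_n)⁻) with §1 (p0002 L101–L110, φ_n : A_n → E_n)] -/
abbrev A2Point (H : Type) [Field H] [CharZero H] : Type :=
  (curveA.twoIsogenyCodomain.baseChange H).toAffine.Point

/-- `N_A = β′ + 1` on `A(ℍ′_n)` (the paper's sign: standard action on the FIXED `A`). [cite: TianYuanZhang2017, §3.1 (chunk p0011 L27–L36, A(K_n)⁻) with §1 (p0002 L101–L110, φ_n : A_n → E_n)] -/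
def normA (D : GenusPointData n) : APoint D.H →+ APoint D.H :=
  Point.map (W' := curveA) D.beta.toAlgHom + AddMonoidHom.id _

/-- `N_E = β′ + 1` on `A₂(ℍ′_n)`. [cite: TianYuanZhang2017, §3.1 (chunk p0011 L27–L36, A(K_n)⁻) with §1 (p0002 L101–L110, φ_n : A_n → E_n)] -/
def normE (D : GenusPointData n) : A2Point D.H →+ A2Point D.H :=
  Point.map (W' := curveA.twoIsogenyCodomain) D.beta.toAlgHom + AddMonoidHom.id _

/-- `φ_H := curveA.twoIsogenyPointsHom H` (TYZ's "2-isogeny from A to E" on `ℍ′_n`-points; T4-equivariant). [cite: TianYuanZhang2017, §3.1 (chunk p0011 L27–L36, A(K_n)⁻) with §1 (p0002 L101–L110, φ_n : A_n → E_n)] -/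
abbrev φH (D : GenusPointData n) : APoint D.H →+ A2Point D.H := curveA.twoIsogenyPointsHom D.H

/-- The coefficient of the SECOND sum of Prop. 3.4 after `β′ + 1`: `Σ_S Σ_{d₀ ∈ S, (5,3,2)-block} ∏_{d ∈ S} g(d)`
(product over ALL blocks — what the derivation gives; immaterial to the parity conclusion). [cite: TianYuanZhang2017, Thm. 3.5 and its proof (chunks p0011 L94–L112, p0020 L107–L165, p0021 L1–L3)] -/
def cI (n : ℕ) : ℕ :=
  ∑ S ∈ decompositions n, ∑ _d₀ ∈ S.filter (fun d₀ => IBlock S d₀), ∏ d ∈ S, gK d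

/-- The `τ`-point TYPE of a main block `d₀` of `S`: `[i]τa` (`d₀ ≡ 5` with a block `≡ 3`), `τa` (`d₀ ≡ 5`
without), `τ(i/2)` (`d₀ ≡ 6`), `τ(1/2)` (`d₀ ≡ 7`). [cite: TianYuanZhang2017, Thm. 3.5 and its proof (chunks p0011 L94–L112, p0020 L107–L165, p0021 L1–L3)] -/
def tauType (D : GenusPointData n) (S : Finset ℕ) (d₀ : ℕ) : APoint D.H :=
  if d₀ % 8 = 5 then (if ∃ d ∈ S, d % 8 = 3 then D.iPt D.tauHalfOneMinusI else D.tauHalfOneMinusI)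
  else if d₀ % 8 = 6 then D.tauIHalf else tauHalf

/-! ### The twist transfer: `θ = √−n`, the equation identities, `Θ_A`, `Θ_E` -/

/-- Instance `curveA_isCharNeTwoNF` (normal-form bookkeeping). [folklore] -/
instance curveA_isCharNeTwoNF : curveA.IsCharNeTwoNF := ⟨rfl, rfl⟩

/-- Instance `curveA₂_isCharNeTwoNF` (normal-form bookkeeping). [folklore] -/
instance curveA₂_isCharNeTwoNF : curveA.twoIsogenyCodomain.IsCharNeTwoNF := ⟨rfl, rfl⟩

/-- `θ = √−n ∈ K_n = GenusField n`. [cite: TianYuanZhang2017, §3.1 (chunk p0011 L27–L36, A(K_n)⁻) with §1 (p0002 L101–L110, φ_n : A_n → E_n)] -/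
abbrev θn (n : ℕ) : GenusField n := AdjoinRoot.root (genusFieldPoly n)

/-- `θ² = −n` in `K_n` (as the image of `−n ∈ ℚ`). [cite: TianYuanZhang2017, §3.1 (chunk p0011 L27–L36, A(K_n)⁻) with §1 (p0002 L101–L110, φ_n : A_n → E_n)] -/
theorem θn_sq (hn : n ≠ 0) : θn n ^ 2 = algebraMap ℚ (GenusField n) (-(n : ℚ)) := by
  rw [map_neg, map_natCast, θn, root_genusField_sq (Nat.one_le_iff_ne_zero.mpr hn)]

/-- `θ ≠ 0`. [cite: TianYuanZhang2017, §3.1 (chunk p0011 L27–L36, A(K_n)⁻) with §1 (p0002 L101–L110, φ_n : A_n → E_n)] -/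
theorem θn_ne_zero (hn : n ≠ 0) : θn n ≠ 0 := by
  intro h
  have h2 := θn_sq hn
  rw [h, zero_pow two_ne_zero, map_neg, map_natCast, zero_eq_neg, Nat.cast_eq_zero] at h2
  exact hn h2

/-- `A_n′ = (congruentNumberCurve n).twoIsogenyCodomain = Y² = X³ + 4n²X` IS `curveA^{(−n)}` (as equations). [cite: TianYuanZhang2017, §3.1 (chunk p0011 L27–L36, A(K_n)⁻) with §1 (p0002 L101–L110, φ_n : A_n → E_n)] -/
theorem Atwo_eq_twist : Atwo n = curveA.quadraticTwist (-(n : ℚ)) := by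
  ext <;> simp [twoIsogenyCodomain, congruentNumberCurve, quadraticTwist, curveA, b₂, b₄, b₆]; ring

/-- The scaling `(x, y) ↦ (4x, 8y)` (`u = 1/2`). [cite: TianYuanZhang2017, §3.1 (chunk p0011 L27–L36, A(K_n)⁻) with §1 (p0002 L101–L110, φ_n : A_n → E_n)] -/
def CE : VariableChange ℚ := ⟨Units.mk0 (2⁻¹ : ℚ) (by norm_num), 0, 0, 0⟩

/-- `(1/2; 0,0,0) • E_n = A₂^{(−n)} = (y² = x³ − 16n²x)`. [cite: TianYuanZhang2017, §3.1 (chunk p0011 L27–L36, A(K_n)⁻) with §1 (p0002 L101–L110, φ_n : A_n → E_n)] -/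
theorem CE_smul : CE • congruentNumberCurve n = curveA.twoIsogenyCodomain.quadraticTwist (-(n : ℚ)) := by
  ext
  · simp [CE, congruentNumberCurve, quadraticTwist, twoIsogenyCodomain, curveA, variableChange_a₁]
  · simp [CE, congruentNumberCurve, quadraticTwist, twoIsogenyCodomain, curveA, b₂, variableChange_a₂]
  · simp [CE, congruentNumberCurve, quadraticTwist, twoIsogenyCodomain, curveA, variableChange_a₃]
  · simp [CE, congruentNumberCurve, quadraticTwist, twoIsogenyCodomain, curveA, b₄, variableChange_a₄]
    ring
  · simp [CE, congruentNumberCurve, quadraticTwist, twoIsogenyCodomain, curveA, b₆, variableChange_a₆]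

/-- Base change of `ℚ`-points to `K`-points of a `ℚ`-curve (domain ascribed as `W.toAffine.Point`). [cite: TianYuanZhang2017, §3.1 (chunk p0011 L27–L36, A(K_n)⁻) with §1 (p0002 L101–L110, φ_n : A_n → E_n)] -/
def ιK (W : WeierstrassCurve ℚ) (K : Type) [Field K] [Algebra ℚ K] :
    W.toAffine.Point →+ (W.baseChange K).toAffine.Point :=
  Point.baseChange (W' := W) ℚ K

/-- **Θ_A : A_n′(ℚ) → A(K_n)**, `(X, Y) ↦ (X/θ², Y/θ³) = (−X/n, −Y/(nθ))`. [cite: TianYuanZhang2017, §3.1 (chunk p0011 L27–L36, A(K_n)⁻) with §1 (p0002 L101–L110, φ_n : A_n → E_n)] -/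
def ΘA (hn : n ≠ 0) : (Atwo n).toAffine.Point →+ APoint (GenusField n) :=
  (untwistEquivAt curveA (θn_sq hn) (θn_ne_zero hn)).toAddMonoidHom.comp
    ((ιK (curveA.quadraticTwist (-(n : ℚ))) (GenusField n)).comp
      (Affine.Point.congrEquiv (Atwo_eq_twist (n := n))).toAddMonoidHom)

/-- **Θ_E : E_n(ℚ) → A₂(K_n)**, `(x, y) ↦ (4x/θ², 8y/θ³) = (−4x/n, −8y/(nθ))`. [cite: TianYuanZhang2017, §3.1 (chunk p0011 L27–L36, A(K_n)⁻) with §1 (p0002 L101–L110, φ_n : A_n → E_n)] -/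
def ΘE (hn : n ≠ 0) : (congruentNumberCurve n).toAffine.Point →+ A2Point (GenusField n) :=
  (untwistEquivAt curveA.twoIsogenyCodomain (θn_sq hn) (θn_ne_zero hn)).toAddMonoidHom.comp
    ((ιK (curveA.twoIsogenyCodomain.quadraticTwist (-(n : ℚ))) (GenusField n)).comp
      ((VariableChange.pointEquiv (congruentNumberCurve n) CE).trans
        (Affine.Point.congrEquiv (CE_smul (n := n)))).toAddMonoidHom)

end Literature.NumberTheory.EllipticCurves.TianYuanZhang2017.W2
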